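import Literature.Geometry.Symplectic.JHolomorphicReparametrisation
import HarnessLib

/-!
# `J`-holomorphic maps on a subset of `ℂ` (holomorphic discs)

Topic `Literature/Geometry/Symplectic`; the LOCAL form of the tree's
`Literature.Geometry.Symplectic.IsJHolomorphic` (`JHolomorphicMap.lean`: `u : ℂ → M` with
`du_z(iζ) = J_{u z}(du_z ζ)` at EVERY `z ∈ ℂ`), written for the fact seat of
`Literature.Geometry.Symplectic.Eliashberg1990_steinFilling_sphere_three` (Eliashberg (1990),
*Filling by holomorphic discs*: the objects of §2–§5 there are `J`-holomorphic DISCS — maps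
holomorphic on the unit disc, not on all of `ℂ`; in a compact Stein domain every entire
`J`-curve is in fact constant, `SteinNoEntireCurves.lean`, so the global notion is void there).
The definition is Hummel's, *Gromov's compactness theorem for pseudo-holomorphic curves* (1997),
Ch. I §3, eq. (3.1): a smooth map `f : (N, j) → (M, J)` of an (open) Riemann surface is
`J`-holomorphic iff `Tf ∘ j = J ∘ Tf`, here for `N = U ⊆ ℂ` with `j = i`
(McDuff–Salamon (2017), §4.5, (4.5.1)).

* `IsJHolomorphicOn I J u U` — `∀ z ∈ U, ∀ ζ, du_z(iζ) = J_{u z}(du_z ζ)` (`du_z = mfderiv`;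
  meaningful for `U` open and `u` differentiable on `U`);
* `isJHolomorphicOn_univ` — on `U = univ` it is `IsJHolomorphic`; `IsJHolomorphic.isJHolomorphicOn`,
  `IsJHolomorphicOn.mono`;
* `IsJHolomorphicOn.mfderiv_apply_eq`, `IsJHolomorphicOn.mfderiv_eq_zero_of_apply_one_eq_zero` —
  `du_z` is complex linear for `J_{u z}` and is determined by `du_z 1`;
* `IsJHolomorphicOn.comp` — reparametrisation by a map `g` complex differentiable on an open `V`
  with `g(V) ⊆ U` (restriction to sub-discs, Möbius reparametrisations);
* `isJHolomorphicOn_modelSpace_iff`, `isJHolomorphicOn_mulByI_iff_differentiableOn` — **faithfulness check**: for maps into a complex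
  normed space with its standard structure `i`, `J`-holomorphic on an open `U` ↔ complex
  differentiable on `U` (Cauchy–Riemann), the local counterpart of the tree's
  `isJHolomorphicFlat_mulByI_iff_differentiable`.

Everything is proved; the only definition is `IsJHolomorphicOn`.

## References

* C. Hummel, *Gromov's Compactness Theorem for Pseudo-holomorphic Curves*, Progress in Math.
  151 (1997), Ch. I §3, Definition and eq. (3.1). [Hummel1997]
* D. McDuff, D. Salamon, *Introduction to Symplectic Topology*, 3rd ed. (2017), §4.5,
  eq. (4.5.1). [McDuffSalamon2017]
* Ya. Eliashberg, *Filling by holomorphic discs and its applications*, LMS Lecture Note Ser. 151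
  (1990), §2–§3 (holomorphic discs). [Eliashberg1990]
-/

noncomputable section

open scoped Manifold ContDiff Topology
open Set

namespace Literature.Geometry.Symplectic

section Manifold

variable {E : Type*} [NormedAddCommGroup E] [NormedSpace ℝ E] {H : Type*} [TopologicalSpace H]
  (I : ModelWithCorners ℝ E H) {M : Type*} [TopologicalSpace M] [ChartedSpace H M]

/-- `u : ℂ → M` is **`J`-holomorphic on `U ⊆ ℂ`**: `du_z(iζ) = J_{u z}(du_z ζ)` for all `z ∈ U`
and `ζ ∈ ℂ`, with `du_z = mfderiv 𝓘(ℝ, ℂ) I u z` (Hummel (1997), Ch. I §3, eq. (3.1)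
`Tf ∘ j = J ∘ Tf` for the Riemann surface `N = U`, `j = i`; McDuff–Salamon (2017), (4.5.1)).
Intended for open `U` and `u` differentiable on `U` (at points of non-differentiability the
condition holds trivially, `mfderiv = 0`); `U` the open unit disc gives `J`-holomorphic discs.
[cite: Hummel1997, Ch. I §3, Definition and eq. (3.1)] -/
def IsJHolomorphicOn (J : ∀ x : M, TangentSpace I x →L[ℝ] TangentSpace I x) (u : ℂ → M)
    (U : Set ℂ) : Prop :=
  ∀ z ∈ U, ∀ ζ : ℂ,
    mfderiv 𝓘(ℝ, ℂ) I u z (Complex.I * ζ : ℂ) = J (u z) (mfderiv 𝓘(ℝ, ℂ) I u z (ζ : ℂ))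

variable {I}
variable {J : ∀ x : M, TangentSpace I x →L[ℝ] TangentSpace I x} {u : ℂ → M} {U V : Set ℂ}

/-- Unfolding `IsJHolomorphicOn` (definitional). [folklore] -/
theorem isJHolomorphicOn_iff :
    IsJHolomorphicOn I J u U ↔ ∀ z ∈ U, ∀ ζ : ℂ,
      mfderiv 𝓘(ℝ, ℂ) I u z (Complex.I * ζ : ℂ) = J (u z) (mfderiv 𝓘(ℝ, ℂ) I u z (ζ : ℂ)) :=
  Iff.rfl

/-- On `U = univ` the local notion is the tree's global one. [folklore] -/
theorem isJHolomorphicOn_univ : IsJHolomorphicOn I J u univ ↔ IsJHolomorphic I J u :=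
  ⟨fun h z ζ => h z (mem_univ z) ζ, fun h z _ ζ => h z ζ⟩

/-- A `J`-holomorphic map `ℂ → M` is `J`-holomorphic on every subset. [folklore] -/
theorem IsJHolomorphic.isJHolomorphicOn (h : IsJHolomorphic I J u) (U : Set ℂ) :
    IsJHolomorphicOn I J u U :=
  fun z _ ζ => h z ζ

namespace IsJHolomorphicOn

/-- Restriction to a smaller set. [folklore] -/
theorem mono (h : IsJHolomorphicOn I J u U) (hVU : V ⊆ U) : IsJHolomorphicOn I J u V :=
  fun z hz ζ => h z (hVU hz) ζ

/-- **Complex linearity of `du_z`** at a point of `U`: `du_z ζ = (Re ζ) du_z 1 + (Im ζ) J (du_z 1)`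
(Hummel (1997), Ch. I §3: "`T_p f` is complex linear"). [cite: Hummel1997, Ch. I §3, Definition and eq. (3.1)] -/
theorem mfderiv_apply_eq (h : IsJHolomorphicOn I J u U) {z : ℂ} (hz : z ∈ U) (ζ : ℂ) :
    mfderiv 𝓘(ℝ, ℂ) I u z ζ =
      (ζ.re : ℝ) • mfderiv 𝓘(ℝ, ℂ) I u z (1 : ℂ) +
        (ζ.im : ℝ) • J (u z) (mfderiv 𝓘(ℝ, ℂ) I u z (1 : ℂ)) := by
  have hdec : ζ = (ζ.re : ℝ) • (1 : ℂ) + (ζ.im : ℝ) • (Complex.I * 1 : ℂ) := by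
    rw [mul_one, Complex.real_smul, Complex.real_smul, mul_one, Complex.re_add_im]
  have key : ∀ (L : ℂ →L[ℝ] E) (j : E →L[ℝ] E), L (Complex.I * 1) = j (L 1) →
      L ζ = (ζ.re : ℝ) • L 1 + (ζ.im : ℝ) • j (L 1) := by
    intro L j hL
    conv_lhs => rw [hdec]
    rw [map_add, map_smul, map_smul, hL]
  exact key _ _ (h z hz 1)

/-- At a point of `U`, `du_z 1 = 0` forces `du_z = 0`. [folklore] -/
theorem mfderiv_eq_zero_of_apply_one_eq_zero (h : IsJHolomorphicOn I J u U) {z : ℂ} (hz : z ∈ U)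
    (h1 : mfderiv 𝓘(ℝ, ℂ) I u z (1 : ℂ) = 0) : mfderiv 𝓘(ℝ, ℂ) I u z = 0 := by
  ext ζ
  rw [h.mfderiv_apply_eq hz ζ, h1, map_zero, smul_zero, smul_zero, add_zero]
  rfl

/-- **Reparametrisation**: if `u` is `J`-holomorphic on `U`, differentiable at the points `g z`,
and `g` is complex differentiable on an open `V` with `g(V) ⊆ U`, then `u ∘ g` is
`J`-holomorphic on `V` (restriction to sub-discs, Möbius and affine reparametrisations).
[cite: Hummel1997, Ch. I §3, Definition and eq. (3.1)] -/
theorem comp (h : IsJHolomorphicOn I J u U) {g : ℂ → ℂ} (hV : IsOpen V)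
    (hg : DifferentiableOn ℂ g V) (hmaps : MapsTo g V U)
    (hu : ∀ z ∈ V, MDifferentiableAt 𝓘(ℝ, ℂ) I u (g z)) : IsJHolomorphicOn I J (u ∘ g) V := by
  intro z hz ζ
  have hgz : DifferentiableAt ℂ g z := hg.differentiableAt (hV.mem_nhds hz)
  have hg' : HasMFDerivAt 𝓘(ℝ, ℂ) 𝓘(ℝ, ℂ) g z ((fderiv ℂ g z).restrictScalars ℝ) :=
    (hgz.hasFDerivAt.restrictScalars ℝ).hasMFDerivAt
  rw [((hu z hz).hasMFDerivAt.comp z hg').mfderiv]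
  have e1 : ((fderiv ℂ g z).restrictScalars ℝ) (Complex.I * ζ) = Complex.I * fderiv ℂ g z ζ := by
    simp only [ContinuousLinearMap.coe_restrictScalars']
    rw [← smul_eq_mul, ContinuousLinearMap.map_smul, smul_eq_mul]
  calc ((mfderiv 𝓘(ℝ, ℂ) I u (g z)).comp ((fderiv ℂ g z).restrictScalars ℝ)) (Complex.I * ζ)
        = mfderiv 𝓘(ℝ, ℂ) I u (g z) (Complex.I * fderiv ℂ g z ζ) :=
          congrArg (mfderiv 𝓘(ℝ, ℂ) I u (g z)) e1
    _ = J (u (g z)) (mfderiv 𝓘(ℝ, ℂ) I u (g z) (fderiv ℂ g z ζ)) := h (g z) (hmaps hz) _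
    _ = J ((u ∘ g) z)
          (((mfderiv 𝓘(ℝ, ℂ) I u (g z)).comp ((fderiv ℂ g z).restrictScalars ℝ)) ζ) := rfl

end IsJHolomorphicOn

end Manifold

/-! ### Faithfulness: for the standard structure, `J`-holomorphic on `U` ↔ holomorphic on `U` -/

section Standard

variable {F : Type*} [NormedAddCommGroup F] [NormedSpace ℂ F]

/-- On a vector space charted by itself, `mfderiv = fderiv`: the local notion in flat terms.
[folklore] -/
theorem isJHolomorphicOn_modelSpace_iff {E' : Type*} [NormedAddCommGroup E'] [NormedSpace ℝ E']
    {J : E' → E' →L[ℝ] E'} {u : ℂ → E'} {U : Set ℂ} :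
    IsJHolomorphicOn 𝓘(ℝ, E') J u U ↔
      ∀ z ∈ U, ∀ ζ : ℂ, fderiv ℝ u z (Complex.I * ζ) = J (u z) (fderiv ℝ u z ζ) := by
  simp only [IsJHolomorphicOn, mfderiv_eq_fderiv]
  exact Iff.rfl

/-- **Cauchy–Riemann, local form.**  For `u : ℂ → F` into a complex normed space,
real-differentiable on the open set `U`: `u` is `J`-holomorphic on `U` for the standard structure
`J = i` (`mulByI`) iff `u` is complex differentiable on `U` (Hummel (1997), Ch. I §3, remark after
(3.1): in complex coordinates (3.1) is the Cauchy–Riemann system).  Local counterpart of the tree's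
`isJHolomorphicFlat_mulByI_iff_differentiable`. [cite: Hummel1997, Ch. I §3 (remark after (3.1))] -/
theorem isJHolomorphicOn_mulByI_iff_differentiableOn {u : ℂ → F} {U : Set ℂ} (hU : IsOpen U)
    (hu : DifferentiableOn ℝ u U) :
    IsJHolomorphicOn 𝓘(ℝ, F) (fun _ => mulByI F) u U ↔ DifferentiableOn ℂ u U := by
  rw [isJHolomorphicOn_modelSpace_iff]
  constructor
  · intro h z hz
    have hz' : DifferentiableAt ℝ u z := hu.differentiableAt (hU.mem_nhds hz)
    refine DifferentiableAt.differentiableWithinAt ?_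
    rw [differentiableAt_iff_restrictScalars ℝ hz']
    exact exists_restrictScalars_eq_of_map_mul_I (fderiv ℝ u z) fun ζ => by
      simpa using h z hz ζ
  · intro h z hz ζ
    have hz' : DifferentiableAt ℂ u z := h.differentiableAt (hU.mem_nhds hz)
    rw [hz'.fderiv_restrictScalars ℝ]
    simp only [ContinuousLinearMap.coe_restrictScalars', mulByI_apply]
    rw [← smul_eq_mul, ContinuousLinearMap.map_smul]

end Standard

end Literature.Geometry.Symplectic
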